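import Summits.AtomisticToContinuum.BoseEinsteinCondensation.Theorems.BoxCountShadowC
import HarnessLib

/-!
# BoxCountShadowDecoupling — continuation of BoxCountShadow(C): the decoupling door DEC_h ⟹ SUF_h (§7)

Continuation of `BoxCountShadow` / `BoxCountShadowB` / `BoxCountShadowC` (same namespace).  The Cauchy–Schwarz gap
behind `labelAffinity ≤ countAffinity` is a fibrewise squared Hellinger distance between «environment given its
horizon counts» and «environment given the counts and the tagged block»; a Bhattacharyya floor on pairs `(m,B)`
carrying half of the count affinity (`GroundStateHorizonCountDecoupling`, DEC_h: count-conditional decoupling) gives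
`GroundStateHorizonCountSufficiency` (SUF_h) with `s = s₀/2` (`horizonCountSufficiency_of_decoupling`), and the
kernel `bec_of_countDecoupling₀ : UGS → LOC_h → NUM_h → DEC_h → BoseEinsteinCondensation`.
No instances, no notation, no sorry.
-/

open MeasureTheory Filter Set
open scoped ENNReal NNReal BigOperators

namespace Summit.AtomisticToContinuum.BoseEinsteinCondensation.Theorems.BoxCountShadow

open Literature.MathematicalPhysics.QuantumManyBody.BoseGas
open Summit.AtomisticToContinuum.BoseEinsteinCondensation.Theorems.BoxLatticeFSum
open Summit.AtomisticToContinuum.BoseEinsteinCondensation.Theorems.BoxLabelAffinity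
open Summit.AtomisticToContinuum.BoseEinsteinCondensation.Theorems.BoxHorizonAffinity

variable {n : ℕ}

/-! ### §7  The decoupling door for SUF_h (critic row 480 order, executed in gen 35)

The Cauchy–Schwarz gap behind `labelAffinity ≤ countAffinity` is, term by term,
`(P̄(m)Q(B,m))^{1/2} − ∫_{F_m} P̂^{1/2} q_B^{1/2} = (P̄Q)^{1/2} · H²(L(Y | m), L(Y | m, x₁ ∈ B))`, the squared
Hellinger distance between the law of the environment GIVEN ITS COUNT FIELD and its law given the count field AND
the block of the tagged particle (Bayes-dual to «label law given `Y`» vs «label law given `m(Y)`»: the likelihood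
ratio is `π_B(Y)/r(B|m)` either way).  Hence the door: a fibrewise Bhattacharyya floor
`BC(L(Y|m), L(Y|m, x₁∈B)) ≥ s₀` on a set `G` of pairs `(m,B)` carrying at least half of the count affinity gives
`labelAffinity ≥ (s₀/2)·countAffinity` — COUNT-CONDITIONAL DECOUPLING of the tagged particle's block from the fine
geometry of the others.  Typed as `GroundStateHorizonCountDecoupling` (DEC_h) with the kernel DEC_h ⟹ SUF_h; DEC_h is
a door (STRONGER-or-equal than SUF_h), an `O(1)`-ratio positivity statement needing no energy resolution. -/

/-- The `(m,B)` term `K^{-3/2} · P̄(m)^{1/2} Q(B,m)^{1/2}` of the count affinity. -/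
noncomputable def countTerm (L : ℝ) (K : ℕ) (Φ : Config (n + 1) → ℝ) (p : (SubIdx K → ℕ) × SubIdx K) : ℝ≥0∞ :=
  blockWeight K * (fibreSlice L K Φ p.1 ^ (1 / 2 : ℝ) * fibreMass L K Φ p.2 p.1 ^ (1 / 2 : ℝ))

/-- `countAffinity = Σ'_m Σ_B countTerm (m,B)`. [folklore] -/
theorem countAffinity_eq_tsum_sum_countTerm (L : ℝ) (K : ℕ) (Φ : Config (n + 1) → ℝ) :
    countAffinity L K Φ = ∑' m : SubIdx K → ℕ, ∑ B : SubIdx K, countTerm L K Φ (m, B) := by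
  unfold countAffinity countTerm
  refine tsum_congr fun m => ?_
  rw [Finset.mul_sum]
  exact Finset.sum_congr rfl fun B _ => by ring

/-- `labelAffinity = Σ'_m Σ_B K^{-3/2} ∫_{F_m} P̂^{1/2} q_B^{1/2}` (fibre decomposition). [folklore] -/
theorem labelAffinity_eq_tsum_sum (L : ℝ) (K : ℕ) {Φ : Config (n + 1) → ℝ} (hΦm : Measurable Φ) :
    labelAffinity L K Φ = ∑' m : SubIdx K → ℕ, ∑ B : SubIdx K, blockWeight K *
      ∫⁻ Y in countVec (L / (K : ℝ)) K ⁻¹' {m}, sliceSq Φ Y ^ (1 / 2 : ℝ) * blockMass L K Φ B Y ^ (1 / 2 : ℝ) := by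
  have hmeas : ∀ B : SubIdx K,
      Measurable fun Y : Config n => sliceSq Φ Y ^ (1 / 2 : ℝ) * blockMass L K Φ B Y ^ (1 / 2 : ℝ) :=
    fun B => ((measurable_sliceSq hΦm).pow_const _).mul ((measurable_blockMass L K hΦm B).pow_const _)
  have hpt : ∀ Y : Config n, sliceSq Φ Y ^ (1 / 2 : ℝ) *
      ∑ B : SubIdx K, blockWeight K * blockMass L K Φ B Y ^ (1 / 2 : ℝ) =
      ∑ B : SubIdx K, blockWeight K * (sliceSq Φ Y ^ (1 / 2 : ℝ) * blockMass L K Φ B Y ^ (1 / 2 : ℝ)) := by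
    intro Y
    rw [Finset.mul_sum]
    exact Finset.sum_congr rfl fun B _ => by ring
  unfold labelAffinity
  rw [lintegral_eq_tsum_fibre volume (measurable_countVec (L / (K : ℝ)) K)]
  refine tsum_congr fun m => ?_
  simp_rw [hpt]
  rw [lintegral_finsetSum' _ fun B _ => ((hmeas B).const_mul (blockWeight K)).aemeasurable]
  exact Finset.sum_congr rfl fun B _ => lintegral_const_mul (blockWeight K) (hmeas B)

/-- **Functional decoupling door (uniform form)**: a fibrewise Bhattacharyya floor between «environment given
counts» and «environment given counts and the tagged block», for every `(m,B)`, gives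
`s₀ · countAffinity ≤ labelAffinity`. [folklore] -/
theorem labelAffinity_ge_of_fibreDecoupling (L : ℝ) (K : ℕ) {Φ : Config (n + 1) → ℝ} (hΦm : Measurable Φ)
    (s₀ : ℝ≥0∞)
    (h : ∀ (m : SubIdx K → ℕ) (B : SubIdx K),
      s₀ * (fibreSlice L K Φ m ^ (1 / 2 : ℝ) * fibreMass L K Φ B m ^ (1 / 2 : ℝ)) ≤
        ∫⁻ Y in countVec (L / (K : ℝ)) K ⁻¹' {m},
          sliceSq Φ Y ^ (1 / 2 : ℝ) * blockMass L K Φ B Y ^ (1 / 2 : ℝ)) :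
    s₀ * countAffinity L K Φ ≤ labelAffinity L K Φ := by
  rw [labelAffinity_eq_tsum_sum L K hΦm, countAffinity_eq_tsum_sum_countTerm, ← ENNReal.tsum_mul_left]
  refine ENNReal.tsum_le_tsum fun m => ?_
  rw [Finset.mul_sum]
  refine Finset.sum_le_sum fun B _ => ?_
  unfold countTerm
  calc s₀ * (blockWeight K * (fibreSlice L K Φ m ^ (1 / 2 : ℝ) * fibreMass L K Φ B m ^ (1 / 2 : ℝ)))
      = blockWeight K * (s₀ * (fibreSlice L K Φ m ^ (1 / 2 : ℝ) * fibreMass L K Φ B m ^ (1 / 2 : ℝ))) := by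
        ring
    _ ≤ blockWeight K * ∫⁻ Y in countVec (L / (K : ℝ)) K ⁻¹' {m},
          sliceSq Φ Y ^ (1 / 2 : ℝ) * blockMass L K Φ B Y ^ (1 / 2 : ℝ) := mul_le_mul' le_rfl (h m B)

/-- **Functional decoupling door (typical form)**: the same floor on a set `G` of pairs `(m,B)` whose complement
carries at most half of the count affinity gives `s₀ · countAffinity ≤ 2 · labelAffinity` (finite `countAffinity`,
finite `s₀`). [folklore] -/
theorem labelAffinity_ge_of_fibreDecouplingOn (L : ℝ) (K : ℕ) {Φ : Config (n + 1) → ℝ} (hΦm : Measurable Φ)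
    (hA : countAffinity L K Φ ≠ ∞) {s₀ : ℝ≥0∞} (hs : s₀ ≠ ∞) (G : Set ((SubIdx K → ℕ) × SubIdx K))
    (hexc : 2 * ∑' m : SubIdx K → ℕ, ∑ B : SubIdx K, Gᶜ.indicator (countTerm L K Φ) (m, B) ≤
      countAffinity L K Φ)
    (h : ∀ (m : SubIdx K → ℕ) (B : SubIdx K), (m, B) ∈ G →
      s₀ * (fibreSlice L K Φ m ^ (1 / 2 : ℝ) * fibreMass L K Φ B m ^ (1 / 2 : ℝ)) ≤
        ∫⁻ Y in countVec (L / (K : ℝ)) K ⁻¹' {m},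
          sliceSq Φ Y ^ (1 / 2 : ℝ) * blockMass L K Φ B Y ^ (1 / 2 : ℝ)) :
    s₀ * countAffinity L K Φ ≤ 2 * labelAffinity L K Φ := by
  have hsplit : countAffinity L K Φ =
      (∑' m : SubIdx K → ℕ, ∑ B : SubIdx K, G.indicator (countTerm L K Φ) (m, B)) +
        ∑' m : SubIdx K → ℕ, ∑ B : SubIdx K, Gᶜ.indicator (countTerm L K Φ) (m, B) := by
    rw [countAffinity_eq_tsum_sum_countTerm, ← ENNReal.tsum_add]
    refine tsum_congr fun m => ?_
    rw [← Finset.sum_add_distrib]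
    exact Finset.sum_congr rfl fun B _ => (Set.indicator_self_add_compl_apply G (countTerm L K Φ) (m, B)).symm
  have hG : s₀ * ∑' m : SubIdx K → ℕ, ∑ B : SubIdx K, G.indicator (countTerm L K Φ) (m, B) ≤
      labelAffinity L K Φ := by
    rw [labelAffinity_eq_tsum_sum L K hΦm, ← ENNReal.tsum_mul_left]
    refine ENNReal.tsum_le_tsum fun m => ?_
    rw [Finset.mul_sum]
    refine Finset.sum_le_sum fun B _ => ?_
    by_cases hp : (m, B) ∈ G
    · rw [Set.indicator_of_mem hp]
      unfold countTerm
      calc s₀ * (blockWeight K * (fibreSlice L K Φ m ^ (1 / 2 : ℝ) * fibreMass L K Φ B m ^ (1 / 2 : ℝ)))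
          = blockWeight K * (s₀ * (fibreSlice L K Φ m ^ (1 / 2 : ℝ) * fibreMass L K Φ B m ^ (1 / 2 : ℝ))) := by
            ring
        _ ≤ blockWeight K * ∫⁻ Y in countVec (L / (K : ℝ)) K ⁻¹' {m},
              sliceSq Φ Y ^ (1 / 2 : ℝ) * blockMass L K Φ B Y ^ (1 / 2 : ℝ) := mul_le_mul' le_rfl (h m B hp)
    · rw [Set.indicator_of_notMem hp, mul_zero]
      exact bot_le
  have hfin : s₀ * countAffinity L K Φ ≠ ∞ := ENNReal.mul_ne_top hs hA
  have key : s₀ * countAffinity L K Φ + s₀ * countAffinity L K Φ ≤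
      2 * labelAffinity L K Φ + s₀ * countAffinity L K Φ := by
    calc s₀ * countAffinity L K Φ + s₀ * countAffinity L K Φ
        = 2 * (s₀ * ∑' m : SubIdx K → ℕ, ∑ B : SubIdx K, G.indicator (countTerm L K Φ) (m, B)) +
            s₀ * (2 * ∑' m : SubIdx K → ℕ, ∑ B : SubIdx K, Gᶜ.indicator (countTerm L K Φ) (m, B)) := by
          rw [hsplit]; ring
      _ ≤ 2 * labelAffinity L K Φ + s₀ * countAffinity L K Φ :=
          add_le_add (mul_le_mul' le_rfl hG) (mul_le_mul' le_rfl hexc)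
  exact (ENNReal.add_le_add_iff_right hfin).1 key

/-- **DEC_h(η)** (door · TAG STRONGER-or-equal than SUF_h(η) (`horizonCountSufficiency_of_decoupling`,
`s = s₀/2`) · UNDECIDED · TRUE-type expected · leaf ATTACKABLE·positivity (one-coordinate, `O(1)`-ratio; no
energy resolution needed)) `GroundStateHorizonCountDecoupling η`: at all sufficiently coarse horizon windows there
is a set `G` of pairs (count field `m`, block `B`) carrying at least half of the count affinity
(`2 · Σ_{(m,B) ∉ G} K^{-3/2} P̄(m)^{1/2} Q(B,m)^{1/2} ≤ countAffinity`) on which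
`∫_{m(Y)=m} P̂^{1/2} q_B^{1/2} ≥ s₀ · P̄(m)^{1/2} Q(B,m)^{1/2}`: the Bhattacharyya coefficient between the law of the
environment given its horizon counts and its law given the counts and «the tagged particle lies in `B`» is `≥ s₀`
— COUNT-CONDITIONAL DECOUPLING (the fine geometry of the others learns a bounded amount, in Hellinger terms, from
the tagged block once the counts are known; dually, the block Papangelou intensity `π_B(Y) = q_B(Y)/P̂(Y)` is
non-intermittent on count fibres).  Natural input: a ONE-COORDINATE block Harnack inequality for `x ↦ Ψ₀(x,Y)`
averaged over blocks of equal count, constants uniform in `N` (only one coordinate moves); in a dilute gas the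
tagged block is visible to the others only through its correlation hole, detectable with probability `≍ ρa³`, so
`s₀ = 1 − O(ρa³)` is the heuristic value.  Why it might fail: the one-coordinate conditional density
`Ψ₀(x,Y)²/P̂(Y)` obeys no closed equation in `x` (the other Laplacians), so no `N`-uniform Harnack is in print; a
count field can be typical for `P̄` yet force atypical geometry.
[cite: LSSY2005, Thm 7.1 (GP box: product-like ground state, decoupling heuristic); GhoshPeres2017, DOI
10.1215/00127094-2017-0002 (conditional law of the inside given the outside: the rigidity side of the same coin)] -/
@[conjecture] def GroundStateHorizonCountDecoupling (η : ℝ≥0) : Prop :=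
  ∀ v : ℝ → ℝ≥0∞, IsRepulsiveFiniteRange v → 0 < scatteringLength v →
    ∃ M₀ : ℝ, 0 < M₀ ∧ ∀ M : ℝ, M₀ ≤ M → ∃ s₀ : ℝ, 0 < s₀ ∧ ∃ ρ₀ : ℝ, 0 < ρ₀ ∧ ∀ ρ : ℝ, 0 < ρ → ρ < ρ₀ →
      ∀ᶠ n : ℕ in atTop,
        (∃ Ψ₀ : Config (n + 1) → ℝ, (∀ X, 0 ≤ Ψ₀ X) ∧
          IsGroundState v (sideLength ρ (n + 1)) (fun X => (Ψ₀ X : ℂ))) →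
        ∀ K : ℕ, 0 < K → InWindow (M * ρ ^ (-(η : ℝ))) ρ (sideLength ρ (n + 1)) K →
          ∃ G : Set ((SubIdx K → ℕ) × SubIdx K),
            2 * (∑' m : SubIdx K → ℕ, ∑ B : SubIdx K,
                Gᶜ.indicator (countTerm (sideLength ρ (n + 1)) K
                  (groundState v (n + 1) (sideLength ρ (n + 1)))) (m, B)) ≤
              countAffinity (sideLength ρ (n + 1)) K (groundState v (n + 1) (sideLength ρ (n + 1))) ∧
            ∀ (m : SubIdx K → ℕ) (B : SubIdx K), (m, B) ∈ G →
              ENNReal.ofReal s₀ *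
                  (fibreSlice (sideLength ρ (n + 1)) K (groundState v (n + 1) (sideLength ρ (n + 1))) m ^
                      (1 / 2 : ℝ) *
                    fibreMass (sideLength ρ (n + 1)) K (groundState v (n + 1) (sideLength ρ (n + 1))) B m ^
                      (1 / 2 : ℝ)) ≤
                ∫⁻ Y in countVec (sideLength ρ (n + 1) / (K : ℝ)) K ⁻¹' {m},
                  sliceSq (groundState v (n + 1) (sideLength ρ (n + 1))) Y ^ (1 / 2 : ℝ) *
                    blockMass (sideLength ρ (n + 1)) K (groundState v (n + 1) (sideLength ρ (n + 1))) B Y ^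
                      (1 / 2 : ℝ)

/-- **DEC_h ⟹ SUF_h** (the door for the ATTACKABLE half, `s = s₀/2`; uses `countAffinity ≤ 1` for the normalised
ground state). [folklore] -/
theorem horizonCountSufficiency_of_decoupling (η : ℝ≥0) (hdec : GroundStateHorizonCountDecoupling η) :
    GroundStateHorizonCountSufficiency η := by
  intro v hv ha
  obtain ⟨M₀, hM₀, h⟩ := hdec v hv ha
  refine ⟨M₀, hM₀, fun M hM => ?_⟩
  obtain ⟨s₀, hs₀, ρ₀, hρ₀, h'⟩ := h M hM
  refine ⟨s₀ / 2, half_pos hs₀, ρ₀, hρ₀, fun ρ hρ hρlt => ?_⟩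
  filter_upwards [h' ρ hρ hρlt] with n hn hex K hK hKw
  have hA : 0 < M * ρ ^ (-(η : ℝ)) := mul_pos (hM₀.trans_le hM) (Real.rpow_pos_of_pos hρ _)
  set L := sideLength ρ (n + 1) with hLdef
  have hL : 0 < L := sideLength_pos_of_inWindow hA hρ hK hKw
  set Φ := groundState v (n + 1) L with hΦdef
  have hΦm : Measurable Φ := measurable_groundState v (n + 1) L
  have hΦ1 : ∫⁻ Y : Config n, ∫⁻ x, ENNReal.ofReal (Φ (Matrix.vecCons x Y)) ^ 2 = 1 := by
    rw [← lintegral_eq_lintegral_lintegral_vecCons (hΦm.ennreal_ofReal.pow_const 2)]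
    exact lintegral_groundState_sq hex
  have hAfin : countAffinity L K Φ ≠ ∞ :=
    ne_top_of_le_ne_top ENNReal.one_ne_top (countAffinity_le_one hL hK hΦm hΦ1)
  obtain ⟨G, hexc, hG⟩ := hn hex K hK hKw
  have h2 : ENNReal.ofReal s₀ * countAffinity L K Φ ≤ 2 * labelAffinity L K Φ :=
    labelAffinity_ge_of_fibreDecouplingOn L K hΦm hAfin ENNReal.ofReal_ne_top G hexc hG
  have hhalf : ENNReal.ofReal (s₀ / 2) = ENNReal.ofReal s₀ / 2 := by
    rw [ENNReal.ofReal_div_of_pos two_pos, ENNReal.ofReal_ofNat]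
  calc ENNReal.ofReal (s₀ / 2) * countAffinity L K Φ
      = (ENNReal.ofReal s₀ * countAffinity L K Φ) / 2 := by
        rw [hhalf, ENNReal.div_eq_inv_mul, ENNReal.div_eq_inv_mul, mul_assoc]
    _ ≤ labelAffinity L K Φ := ENNReal.div_le_of_le_mul (h2.trans_eq (mul_comm _ _))

/-- LAB_h(η) ⟸ NUM_h(η) ∧ DEC_h(η), and the kernel through the door:
UGS → LOC_h(η) → NUM_h(η) → DEC_h(η) → `BoseEinsteinCondensation`. [folklore] -/
theorem bec_of_countDecoupling₀ (η : ℝ≥0) (hU : BoxGroundStateUniqueness)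
    (hloc : GroundStateHorizonCondensation η) (hnum : GroundStateHorizonCountAffinity η)
    (hdec : GroundStateHorizonCountDecoupling η) : _root_.BoseEinsteinCondensation :=
  bec_of_countPieces₀ η hU hloc hnum (horizonCountSufficiency_of_decoupling η hdec)

end Summit.AtomisticToContinuum.BoseEinsteinCondensation.Theorems.BoxCountShadow
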